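import Summits.HubbardSuperconductivity.HubbardSuperconductivity.Theorems.JosephsonMirrorJmCuspNormalForm
import Summits.HubbardSuperconductivity.HubbardSuperconductivity.Theorems.JosephsonMirrorJmCuspCocountableSelection
import Summits.HubbardSuperconductivity.HubbardSuperconductivity.Theorems.JosephsonMirrorJmCuspPencilFiniteness
import Summits.HubbardSuperconductivity.HubbardSuperconductivity.Theorems.JosephsonMirrorJmCuspLogColdWindowOrder
import Summits.HubbardSuperconductivity.HubbardSuperconductivity.Theorems.JosephsonMirrorJmCuspOrderedWindowSuppliers
import HarnessLib

/-!
# Route `JosephsonMirror` — crux `JmCusp` (stmt-HubbardSuperconductivity-2228): conditional assembly of line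
# `cocountable-coupling-selection`

Helper file (`--supports` stmt-HubbardSuperconductivity-2228) of the lead seat c11 of the crux `JmCusp`
(`Theses/JosephsonMirror.lean`: some `(U, δ)` carries (i) a uniform linear Josephson gain of the window double and
(ii) an eventually simple `(N_L, S^z = 0)` ground floor).  The line `cocountable-coupling-selection`
(`Cruxes/JmCusp/Lines/cocountable_coupling_selection.lean`) has landed all of its provable stubs
(`stub_pencilFiniteness`, `stub_cocountableSelection`, `stub_logColdGivesWindowOrder`, and the supplier glue
`orderedWindow_of_bir2079` / `orderedWindow_of_thesis1634`); what remains are two crux-sized inputs — a coupling WINDOW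
of zero-excess `d`-wave pair order (the summit's open core, supplied verbatim by any of the open items stmt-8807,
stmt-2079, stmt-1634) and a conjecture-grade (ii)-RESIDUE.  This file is the sorry-free composition: it proves the crux
`JmCusp` BY NAME from those inputs taken as hypotheses, for four successively weaker forms of the residue, so that the
planners can file the residue as an item in whichever form they choose and close the crux by a one-line application:

* `windowOrder_mono` — window order restricts to sub-windows;
* `jmCusp_of_windowOrder_of_eventuallySimple` — window order + ONE coupling of the window with an eventually simple
  floor ⇒ `JmCusp` (normal form `jmCusp_iff_zeroExcessPairOrder_and_simple`, p134917);
* `jmCusp_of_windowOrder_of_countable_recurrent` — window order + the couplings of the window whose floor is degenerate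
  for infinitely many even `L` form a COUNTABLE set ⇒ `JmCusp` (an interval is uncountable, `not_countable_Ioo`);
* `jmCusp_of_windowOrder_of_finiteDegenerate` — window order + eventually in `L` only FINITELY many couplings of the
  window have a degenerate floor ⇒ `JmCusp` (co-countable selection, `stub_cocountableSelection`, p151542);
* `jmCusp_of_windowOrder_of_denseSimple` — window order + eventually in `L` the simple-floor couplings are DENSE in the
  window ⇒ `JmCusp` (pencil finiteness `stub_pencilFiniteness`, p152004: the bottom eigenvalue multiplicity of the
  linear Hermitian pencil `T + U·D` is locally constant off a finite set, so density leaves finitely many exceptions);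
* `jmCusp_of_orderedWindow_of_genericSimplicity` — the line's composition with BOTH remaining stubs as hypotheses:
  an ordered window (existential) and the residue in its registered universal form "every ordered window contains a
  sub-window on which, eventually in even `L`, the simple-floor couplings are dense";
* `jmCusp_of_logColdDWaveOrder_of_genericSimplicity`, `jmCusp_of_bir2079_of_genericSimplicity`,
  `jmCusp_of_thesis1634_of_genericSimplicity` — the same with the window supplied by the STATEMENT (verbatim) of the
  existing open items stmt-8807 `LogColdTorus.LogColdDWaveOrder`, stmt-2079 `BalabanIR.BirGroundStateAverageLRO`,
  stmt-1634 `AbelianDuality.Thesis` respectively (glue p152504, p152676).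

So, by theorems: `JmCusp ⇐ [stmt-8807 ∨ stmt-2079 ∨ stmt-1634] ∧ [generic-simplicity residue]`.  Pure composition of
landed lemmas; no definition, no named fact, no physics input.  Sources for the ingredients: T. Kato, *Perturbation
Theory for Linear Operators* (1966) Ch. II §6 (analytic pencils); T. Koma, H. Tasaki, J. Stat. Phys. 76 (1994) 745, §2.
-/

noncomputable section

-- the mandated namespace `Summit.<Summit>.<Problem>.Theorems` repeats `HubbardSuperconductivity`
-- (single-problem summit, D-0017), which the `dupNamespace` linter flags on every declaration
set_option linter.dupNamespace false

namespace Summit.HubbardSuperconductivity.HubbardSuperconductivity.Theorems.JosephsonMirror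

open scoped Classical
open Matrix Literature.MathematicalPhysics.QuantumLattice
open Summit.HubbardSuperconductivity.HubbardSuperconductivity.Theses.JosephsonMirror (JmCusp)

/-! ### Window order restricts -/

/-- Zero-excess `d`-wave pair order at every coupling of a window `(a, b)` restricts to every sub-window
`(a', b') ⊆ (a, b)`. [folklore] -/
theorem windowOrder_mono {δ a b a' b' : ℝ} (haa' : a ≤ a') (hb'b : b' ≤ b)
    (hZ : ∀ U ∈ Set.Ioo a b, ∃ c : ℝ, 0 < c ∧ ∀ ε : ℝ, 0 < ε → ∃ L₀ : ℕ, ∀ (L : ℕ) [NeZero L], Even L → L₀ ≤ L → ∃ n : ℕ, (n = 2 * ⌊(1 - δ) * (L : ℝ) ^ 2 / 2⌋₊ ∨ n = 2 * ⌊(1 - δ) * (L : ℝ) ^ 2 / 2⌋₊ - 2) ∧ ∃ v : Fock (Orb (FermionTorus 2 L)), v ∈ szSector n 0 ∧ star v ⬝ᵥ v = 1 ∧ (star v ⬝ᵥ (hubbardTorus 2 L 1 U *ᵥ v)).re ≤ (hubbardTorus 2 L 1 U).minEnergyOn (szSector n 0) + ε * (L : ℝ) ^ 2 ∧ c * (L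 : ℝ) ^ 4 ≤ (star (pairField dWaveFormFactor L *ᵥ v) ⬝ᵥ (pairField dWaveFormFactor L *ᵥ v)).re) :
    ∀ U ∈ Set.Ioo a' b', ∃ c : ℝ, 0 < c ∧ ∀ ε : ℝ, 0 < ε → ∃ L₀ : ℕ, ∀ (L : ℕ) [NeZero L], Even L → L₀ ≤ L → ∃ n : ℕ, (n = 2 * ⌊(1 - δ) * (L : ℝ) ^ 2 / 2⌋₊ ∨ n = 2 * ⌊(1 - δ) * (L : ℝ) ^ 2 / 2⌋₊ - 2) ∧ ∃ v : Fock (Orb (FermionTorus 2 L)), v ∈ szSector n 0 ∧ star v ⬝ᵥ v = 1 ∧ (star v ⬝ᵥ (hubbardTorus 2 L 1 U *ᵥ v)).re ≤ (hubbardTorus 2 L 1 U).minEnergyOn (szSector n 0) + ε * (L : ℝ) ^ 2 ∧ c * (L : ℝ) ^ 4 ≤ (star (pairField dWaveFormFactor L *ᵥ v) ⬝ᵥ (pairField dWaveFormFactor L *ᵥ v)).re :=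
  fun U hU => hZ U ⟨lt_of_le_of_lt haa' hU.1, lt_of_lt_of_le hU.2 hb'b⟩

/-! ### Four forms of the (ii)-residue, weakest first -/

/-- **Window order + one eventually simple coupling ⇒ `JmCusp`.**  If zero-excess `d`-wave pair order holds at every
coupling of a window `(a, b)`, `0 < a`, at doping `δ ∈ (0, 1/2)`, and SOME coupling `U` of the window has a simple
`(N_L, S^z = 0)` ground floor of `hubbardTorus 2 L 1 U` for every large even `L`, then the crux holds at `(U, δ)`
(normal form `jmCusp_iff_zeroExcessPairOrder_and_simple`).  This is the weakest residue the line can use. [folklore] -/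
theorem jmCusp_of_windowOrder_of_eventuallySimple {δ a b : ℝ} (hδ : δ ∈ Set.Ioo (0:ℝ) (1 / 2)) (ha : 0 < a)
    (hZ : ∀ U ∈ Set.Ioo a b, ∃ c : ℝ, 0 < c ∧ ∀ ε : ℝ, 0 < ε → ∃ L₀ : ℕ, ∀ (L : ℕ) [NeZero L], Even L → L₀ ≤ L → ∃ n : ℕ, (n = 2 * ⌊(1 - δ) * (L : ℝ) ^ 2 / 2⌋₊ ∨ n = 2 * ⌊(1 - δ) * (L : ℝ) ^ 2 / 2⌋₊ - 2) ∧ ∃ v : Fock (Orb (FermionTorus 2 L)), v ∈ szSector n 0 ∧ star v ⬝ᵥ v = 1 ∧ (star v ⬝ᵥ (hubbardTorus 2 L 1 U *ᵥ v)).re ≤ (hubbardTorus 2 L 1 U).minEnergyOn (szSector n 0) + ε * (L : ℝ) ^ 2 ∧ c * (L : ℝ) ^ 4 ≤ (star (pairField dWaveFormFactor L *ᵥ v) ⬝ᵥ (pairField dWaveFormFactor L *ᵥ v)).re)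
    (hpt : ∃ U ∈ Set.Ioo a b, ∃ L₁ : ℕ, ∀ (L : ℕ) [NeZero L], Even L → L₁ ≤ L → ∀ φ φ' : Fock (Orb (FermionTorus 2 L)), IsGroundStateInSector (hubbardTorus 2 L 1 U) (2 * ⌊(1 - δ) * (L : ℝ) ^ 2 / 2⌋₊) 0 φ → IsGroundStateInSector (hubbardTorus 2 L 1 U) (2 * ⌊(1 - δ) * (L : ℝ) ^ 2 / 2⌋₊) 0 φ' → ∃ c : ℂ, φ' = c • φ) :
    JmCusp := by
  obtain ⟨U, hUW, L₁, hgood⟩ := hpt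
  have hU : 0 < U := lt_trans ha hUW.1
  refine jmCusp_iff_zeroExcessPairOrder_and_simple.2 ⟨U, hU, δ, hδ, hZ U hUW, ?_⟩
  refine ⟨max L₁ 1, fun L hE hL φ φ' hφ hφ' => ?_⟩
  haveI : NeZero L := ⟨by omega⟩
  exact hgood L hE (le_trans (le_max_left _ _) hL) φ φ' hφ hφ'

/-- **Window order + countably many recurrently degenerate couplings ⇒ `JmCusp`.**  If zero-excess `d`-wave pair order
holds at every coupling of a window `(a, b)`, `0 < a < b`, and the set of couplings of the window at which the
`(N_L, S^z = 0)` floor is degenerate for INFINITELY MANY even `L` is countable, then `JmCusp` holds: the interval is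
uncountable (`not_countable_Ioo`), so some coupling of the window is degenerate only finitely often, i.e. eventually
simple. [folklore] -/
theorem jmCusp_of_windowOrder_of_countable_recurrent {δ a b : ℝ} (hδ : δ ∈ Set.Ioo (0:ℝ) (1 / 2)) (ha : 0 < a)
    (hab : a < b) (hZ : ∀ U ∈ Set.Ioo a b, ∃ c : ℝ, 0 < c ∧ ∀ ε : ℝ, 0 < ε → ∃ L₀ : ℕ, ∀ (L : ℕ) [NeZero L], Even L → L₀ ≤ L → ∃ n : ℕ, (n = 2 * ⌊(1 - δ) * (L : ℝ) ^ 2 / 2⌋₊ ∨ n = 2 * ⌊(1 - δ) * (L : ℝ) ^ 2 / 2⌋₊ - 2) ∧ ∃ v : Fock (Orb (FermionTorus 2 L)), v ∈ szSector n 0 ∧ star v ⬝ᵥ v = 1 ∧ (star v ⬝ᵥ (hubbardTorus 2 L 1 U *ᵥ v)).re ≤ (hubbardTorus 2 L 1 U).minEnergyOn (szSector n 0) + ε * (L : ℝ) ^ 2 ∧ c * (L : ℝ) ^ 4 ≤ (star (pairField dWaveFormFactor L *ᵥ v) ⬝ᵥ (pairField dWaveFormFactor L *ᵥ v)).re)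
    (hcnt : Set.Countable {U : ℝ | U ∈ Set.Ioo a b ∧ ∀ L₁ : ℕ, ∃ L : ℕ, L ≠ 0 ∧ Even L ∧ L₁ ≤ L ∧ ¬ ∀ φ φ' : Fock (Orb (FermionTorus 2 L)), IsGroundStateInSector (hubbardTorus 2 L 1 U) (2 * ⌊(1 - δ) * (L : ℝ) ^ 2 / 2⌋₊) 0 φ → IsGroundStateInSector (hubbardTorus 2 L 1 U) (2 * ⌊(1 - δ) * (L : ℝ) ^ 2 / 2⌋₊) 0 φ' → ∃ c : ℂ, φ' = c • φ}) :
    JmCusp := by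
  have hns : ¬ (Set.Ioo a b ⊆ {U : ℝ | U ∈ Set.Ioo a b ∧ ∀ L₁ : ℕ, ∃ L : ℕ, L ≠ 0 ∧ Even L ∧ L₁ ≤ L ∧ ¬ ∀ φ φ' : Fock (Orb (FermionTorus 2 L)), IsGroundStateInSector (hubbardTorus 2 L 1 U) (2 * ⌊(1 - δ) * (L : ℝ) ^ 2 / 2⌋₊) 0 φ → IsGroundStateInSector (hubbardTorus 2 L 1 U) (2 * ⌊(1 - δ) * (L : ℝ) ^ 2 / 2⌋₊) 0 φ' → ∃ c : ℂ, φ' = c • φ}) :=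
    fun hsub => not_countable_Ioo hab (hcnt.mono hsub)
  obtain ⟨U, hUW, hUR⟩ := Set.not_subset.1 hns
  have hUR' : ¬ (U ∈ Set.Ioo a b ∧ ∀ L₁ : ℕ, ∃ L : ℕ, L ≠ 0 ∧ Even L ∧ L₁ ≤ L ∧ ¬ ∀ φ φ' : Fock (Orb (FermionTorus 2 L)), IsGroundStateInSector (hubbardTorus 2 L 1 U) (2 * ⌊(1 - δ) * (L : ℝ) ^ 2 / 2⌋₊) 0 φ → IsGroundStateInSector (hubbardTorus 2 L 1 U) (2 * ⌊(1 - δ) * (L : ℝ) ^ 2 / 2⌋₊) 0 φ' → ∃ c : ℂ, φ' = c • φ) := hUR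
  push Not at hUR'
  obtain ⟨L₁, hgood⟩ := hUR' hUW
  exact jmCusp_of_windowOrder_of_eventuallySimple hδ ha hZ
    ⟨U, hUW, L₁, fun L _ hE hL => hgood L (NeZero.ne L) hE hL⟩

/-- **Window order + eventually finitely many degenerate couplings ⇒ `JmCusp`.**  If zero-excess `d`-wave pair order
holds at every coupling of a window `(a, b)`, `0 < a < b`, and from some `L₁` on, at each even `L`, only finitely many
couplings of the window have a degenerate `(N_L, S^z = 0)` floor, then `JmCusp` holds: a countable union of finite
sets misses a point of the window (`stub_cocountableSelection`, p151542), which is then eventually simple. [folklore] -/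
theorem jmCusp_of_windowOrder_of_finiteDegenerate {δ a b : ℝ} (hδ : δ ∈ Set.Ioo (0:ℝ) (1 / 2)) (ha : 0 < a)
    (hab : a < b) (hZ : ∀ U ∈ Set.Ioo a b, ∃ c : ℝ, 0 < c ∧ ∀ ε : ℝ, 0 < ε → ∃ L₀ : ℕ, ∀ (L : ℕ) [NeZero L], Even L → L₀ ≤ L → ∃ n : ℕ, (n = 2 * ⌊(1 - δ) * (L : ℝ) ^ 2 / 2⌋₊ ∨ n = 2 * ⌊(1 - δ) * (L : ℝ) ^ 2 / 2⌋₊ - 2) ∧ ∃ v : Fock (Orb (FermionTorus 2 L)), v ∈ szSector n 0 ∧ star v ⬝ᵥ v = 1 ∧ (star v ⬝ᵥ (hubbardTorus 2 L 1 U *ᵥ v)).re ≤ (hubbardTorus 2 L 1 U).minEnergyOn (szSector n 0) + ε * (L : ℝ) ^ 2 ∧ c * (L : ℝ) ^ 4 ≤ (star (pairField dWaveFormFactor L *ᵥ v) ⬝ᵥ (pairField dWaveFormFactor L *ᵥ v)).re)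
    (hfin : ∃ L₁ : ℕ, ∀ (L : ℕ) [NeZero L], Even L → L₁ ≤ L →
      Set.Finite {U : ℝ | U ∈ Set.Ioo a b ∧ ¬ ∀ φ φ' : Fock (Orb (FermionTorus 2 L)), IsGroundStateInSector (hubbardTorus 2 L 1 U) (2 * ⌊(1 - δ) * (L : ℝ) ^ 2 / 2⌋₊) 0 φ → IsGroundStateInSector (hubbardTorus 2 L 1 U) (2 * ⌊(1 - δ) * (L : ℝ) ^ 2 / 2⌋₊) 0 φ' → ∃ c : ℂ, φ' = c • φ}) :
    JmCusp := by
  obtain ⟨L₁, hfin⟩ := hfin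
  obtain ⟨U, hUW, hgood⟩ := stub_cocountableSelection δ a b L₁ hab hfin
  exact jmCusp_of_windowOrder_of_eventuallySimple hδ ha hZ ⟨U, hUW, L₁, hgood⟩

/-- **Window order + eventually dense simplicity ⇒ `JmCusp`.**  If zero-excess `d`-wave pair order holds at every
coupling of a window `(a, b)`, `0 < a < b`, and from some `L₁` on, at each even `L`, the couplings with a simple
`(N_L, S^z = 0)` floor are dense in `(a, b)` (one in every sub-interval), then `JmCusp` holds: the bottom-eigenvalue
multiplicity of the linear Hermitian pencil `U ↦ hubbardTorus 2 L 1 U` on the sector is locally constant off a finite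
set (`stub_pencilFiniteness`, p152004; Kato 1966 II §6), so density leaves finitely many degenerate couplings at each
large `L`, and `jmCusp_of_windowOrder_of_finiteDegenerate` applies. [folklore] -/
theorem jmCusp_of_windowOrder_of_denseSimple {δ a b : ℝ} (hδ : δ ∈ Set.Ioo (0:ℝ) (1 / 2)) (ha : 0 < a)
    (hab : a < b) (hZ : ∀ U ∈ Set.Ioo a b, ∃ c : ℝ, 0 < c ∧ ∀ ε : ℝ, 0 < ε → ∃ L₀ : ℕ, ∀ (L : ℕ) [NeZero L], Even L → L₀ ≤ L → ∃ n : ℕ, (n = 2 * ⌊(1 - δ) * (L : ℝ) ^ 2 / 2⌋₊ ∨ n = 2 * ⌊(1 - δ) * (L : ℝ) ^ 2 / 2⌋₊ - 2) ∧ ∃ v : Fock (Orb (FermionTorus 2 L)), v ∈ szSector n 0 ∧ star v ⬝ᵥ v = 1 ∧ (star v ⬝ᵥ (hubbardTorus 2 L 1 U *ᵥ v)).re ≤ (hubbardTorus 2 L 1 U).minEnergyOn (szSector n 0) + ε * (L : ℝ) ^ 2 ∧ c * (L : ℝ) ^ 4 ≤ (star (pairField dWaveFormFactor L *ᵥ v)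 ⬝ᵥ (pairField dWaveFormFactor L *ᵥ v)).re)
    (hdense : ∃ L₁ : ℕ, ∀ (L : ℕ) [NeZero L], Even L → L₁ ≤ L →
      ∀ a' b' : ℝ, a ≤ a' → a' < b' → b' ≤ b → ∃ U ∈ Set.Ioo a' b', ∀ φ φ' : Fock (Orb (FermionTorus 2 L)), IsGroundStateInSector (hubbardTorus 2 L 1 U) (2 * ⌊(1 - δ) * (L : ℝ) ^ 2 / 2⌋₊) 0 φ → IsGroundStateInSector (hubbardTorus 2 L 1 U) (2 * ⌊(1 - δ) * (L : ℝ) ^ 2 / 2⌋₊) 0 φ' → ∃ c : ℂ, φ' = c • φ) :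
    JmCusp := by
  obtain ⟨L₁, hdense⟩ := hdense
  exact jmCusp_of_windowOrder_of_finiteDegenerate hδ ha hab hZ
    ⟨L₁, fun L _ hE hL => stub_pencilFiniteness L δ a b hab (hdense L hE hL)⟩

/-! ### The line's composition: both remaining stubs as hypotheses -/

/-- **Line `cocountable-coupling-selection`, composed.**  From its two remaining registered stubs taken as hypotheses
— `hA`: an ordered window (some doping `δ ∈ (0, 1/2)` and couplings `0 < a < b` with zero-excess `d`-wave pair order
at every `U ∈ (a, b)`; the summit's open core in window form) and `hR`: the generic-simplicity residue (every ordered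
window contains a sub-window on which, eventually in even `L`, the simple-floor couplings are dense) — the crux
`JmCusp` follows: restrict the order to the sub-window (`windowOrder_mono`) and apply
`jmCusp_of_windowOrder_of_denseSimple`. [folklore] -/
theorem jmCusp_of_orderedWindow_of_genericSimplicity : (∃ δ ∈ Set.Ioo (0:ℝ) (1 / 2), ∃ a b : ℝ, 0 < a ∧ a < b ∧ ∀ U ∈ Set.Ioo a b, ∃ c : ℝ, 0 < c ∧ ∀ ε : ℝ, 0 < ε → ∃ L₀ : ℕ, ∀ (L : ℕ) [NeZero L], Even L → L₀ ≤ L → ∃ n : ℕ, (n = 2 * ⌊(1 - δ) * (L : ℝ) ^ 2 / 2⌋₊ ∨ n = 2 * ⌊(1 - δ) * (L : ℝ) ^ 2 / 2⌋₊ - 2) ∧ ∃ v : Literature.MathematicalPhysics.QuantumLattice.Fock (Literature.MathematicalPhysics.QuantumLattice.Orb (Literature.MathematicalPhysics.QuantumLattice.FermionTorus 2 L)), v ∈ Literature.MathematicalPhysics.QuantumLattice.szSector n 0 ∧ star v ⬝ᵥ v = 1 ∧ (star v ⬝ᵥ (Literature.MathematicalPhysics.QuantumLattice.hubbardTorus 2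 L 1 U *ᵥ v)).re ≤ (Literature.MathematicalPhysics.QuantumLattice.hubbardTorus 2 L 1 U).minEnergyOn (Literature.MathematicalPhysics.QuantumLattice.szSector n 0) + ε * (L : ℝ) ^ 2 ∧ c * (L : ℝ) ^ 4 ≤ (star (Literature.MathematicalPhysics.QuantumLattice.pairField Literature.MathematicalPhysics.QuantumLattice.dWaveFormFactor L *ᵥ v) ⬝ᵥ (Literature.MathematicalPhysics.QuantumLattice.pairField Literature.MathematicalPhysics.QuantumLattice.dWaveFormFactor L *ᵥ v)).re) → (∀ δ ∈ Set.Ioo (0:ℝ) (1 / 2), ∀ a b : ℝ, 0 < a → a < b → (∀ U ∈ Set.Ioo a b, ∃ c : ℝ, 0 < c ∧ ∀ ε : ℝ, 0 < ε → ∃ L₀ : ℕ, ∀ (L : ℕ) [NeZero L], Even L → L₀ ≤ L → ∃ n : ℕ, (n = 2 * ⌊(1 - δ) * (L : ℝ) ^ 2 / 2⌋₊ ∨ n = 2 * ⌊(1 - δ) * (L : ℝ) ^ 2 / 2⌋₊ - 2) ∧ ∃ v : Literature.MathematicalPhysics.QuantumLattice.Fock (Literature.MathematicalPhysics.QuantumLattice.Orb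 (Literature.MathematicalPhysics.QuantumLattice.FermionTorus 2 L)), v ∈ Literature.MathematicalPhysics.QuantumLattice.szSector n 0 ∧ star v ⬝ᵥ v = 1 ∧ (star v ⬝ᵥ (Literature.MathematicalPhysics.QuantumLattice.hubbardTorus 2 L 1 U *ᵥ v)).re ≤ (Literature.MathematicalPhysics.QuantumLattice.hubbardTorus 2 L 1 U).minEnergyOn (Literature.MathematicalPhysics.QuantumLattice.szSector n 0) + ε * (L : ℝ) ^ 2 ∧ c * (L : ℝ) ^ 4 ≤ (star (Literature.MathematicalPhysics.QuantumLattice.pairField Literature.MathematicalPhysics.QuantumLattice.dWaveFormFactor L *ᵥ v) ⬝ᵥ (Literature.MathematicalPhysics.QuantumLattice.pairField Literature.MathematicalPhysics.QuantumLattice.dWaveFormFactor L *ᵥ v)).re) → ∃ a' b' : ℝ, a ≤ a' ∧ a' < b' ∧ b' ≤ b ∧ ∃ L₁ : ℕ, ∀ (L : ℕ) [NeZero L], Even L → L₁ ≤ L → ∀ a'' b'' : ℝ, a' ≤ a'' → a'' < b'' → b'' ≤ b' → ∃ U ∈ Set.Ioo a'' b'', ∀ φ φ' : Literature.MathematicalPhysics.QuantumLattice.Fock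 (Literature.MathematicalPhysics.QuantumLattice.Orb (Literature.MathematicalPhysics.QuantumLattice.FermionTorus 2 L)), Literature.MathematicalPhysics.QuantumLattice.IsGroundStateInSector (Literature.MathematicalPhysics.QuantumLattice.hubbardTorus 2 L 1 U) (2 * ⌊(1 - δ) * (L : ℝ) ^ 2 / 2⌋₊) 0 φ → Literature.MathematicalPhysics.QuantumLattice.IsGroundStateInSector (Literature.MathematicalPhysics.QuantumLattice.hubbardTorus 2 L 1 U) (2 * ⌊(1 - δ) * (L : ℝ) ^ 2 / 2⌋₊) 0 φ' → ∃ c : ℂ, φ' = c • φ) → Summit.HubbardSuperconductivity.HubbardSuperconductivity.Theses.JosephsonMirror.JmCusp := by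
  intro hA hR
  obtain ⟨δ, hδ, a, b, ha, hab, hZ⟩ := hA
  obtain ⟨a', b', haa', ha'b', hb'b, L₁, hdense⟩ := hR δ hδ a b ha hab hZ
  exact jmCusp_of_windowOrder_of_denseSimple hδ (lt_of_lt_of_le ha haa') ha'b' (windowOrder_mono haa' hb'b hZ)
    ⟨L₁, hdense⟩

/-! ### The window supplied by the existing open core items (statements verbatim) -/

/-- **stmt-8807 ∧ residue ⇒ `JmCusp`.**  The statement of stmt-HubbardSuperconductivity-8807
`LogColdTorus.LogColdDWaveOrder` (sector-compressed Gibbs `d`-wave order `≥ c L⁴` at `β = κ log L` on a coupling window,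
verbatim) and the generic-simplicity residue give the crux: `stub_logColdGivesWindowOrder` (p152504) turns the log-cold
order into an ordered window. [folklore] -/
theorem jmCusp_of_logColdDWaveOrder_of_genericSimplicity : (∃ δ ∈ Set.Ioo (0:ℝ) (1/2), ∃ U₁ U₂ : ℝ, 0 < U₁ ∧ U₁ < U₂ ∧ ∃ κ₀ c : ℝ, 0 < κ₀ ∧ 0 < c ∧ ∀ κ : ℝ, κ₀ ≤ κ → ∃ L₀ : ℕ, ∀ U ∈ Set.Ioo U₁ U₂, ∀ (L : ℕ) [NeZero L], L₀ ≤ L → Even L → let p : Finset (Literature.MathematicalPhysics.QuantumLattice.Orb (Literature.MathematicalPhysics.QuantumLattice.FermionTorus 2 L)) → Prop := fun s => s.card = 2 * ⌊(1 - δ) * (L : ℝ) ^ 2 / 2⌋₊ ∧ 2 * (s.filter fun i => (ofLex i).2 = 0).card = 2 * ⌊(1 - δ) * (L : ℝ) ^ 2 / 2⌋₊; c * (L : ℝ) ^ 4 ≤ (Matrix.gibbsState (κ * Real.log L) ((Literature.MathematicalPhysics.QuantumLattice.hubbardTorus 2 L 1 U).toBlock p p) (((Literature.MathematicalPhysics.QuantumLattice.pairField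 Literature.MathematicalPhysics.QuantumLattice.dWaveFormFactor L)ᴴ * Literature.MathematicalPhysics.QuantumLattice.pairField Literature.MathematicalPhysics.QuantumLattice.dWaveFormFactor L).toBlock p p)).re) → (∀ δ ∈ Set.Ioo (0:ℝ) (1 / 2), ∀ a b : ℝ, 0 < a → a < b → (∀ U ∈ Set.Ioo a b, ∃ c : ℝ, 0 < c ∧ ∀ ε : ℝ, 0 < ε → ∃ L₀ : ℕ, ∀ (L : ℕ) [NeZero L], Even L → L₀ ≤ L → ∃ n : ℕ, (n = 2 * ⌊(1 - δ) * (L : ℝ) ^ 2 / 2⌋₊ ∨ n = 2 * ⌊(1 - δ) * (L : ℝ) ^ 2 / 2⌋₊ - 2) ∧ ∃ v : Literature.MathematicalPhysics.QuantumLattice.Fock (Literature.MathematicalPhysics.QuantumLattice.Orb (Literature.MathematicalPhysics.QuantumLattice.FermionTorus 2 L)), v ∈ Literature.MathematicalPhysics.QuantumLattice.szSector n 0 ∧ star v ⬝ᵥ v = 1 ∧ (star v ⬝ᵥ (Literature.MathematicalPhysics.QuantumLattice.hubbardTorus 2 L 1 U *ᵥ v)).re ≤ (Literature.MathematicalPhysics.QuantumLattice.hubbardTorus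 2 L 1 U).minEnergyOn (Literature.MathematicalPhysics.QuantumLattice.szSector n 0) + ε * (L : ℝ) ^ 2 ∧ c * (L : ℝ) ^ 4 ≤ (star (Literature.MathematicalPhysics.QuantumLattice.pairField Literature.MathematicalPhysics.QuantumLattice.dWaveFormFactor L *ᵥ v) ⬝ᵥ (Literature.MathematicalPhysics.QuantumLattice.pairField Literature.MathematicalPhysics.QuantumLattice.dWaveFormFactor L *ᵥ v)).re) → ∃ a' b' : ℝ, a ≤ a' ∧ a' < b' ∧ b' ≤ b ∧ ∃ L₁ : ℕ, ∀ (L : ℕ) [NeZero L], Even L → L₁ ≤ L → ∀ a'' b'' : ℝ, a' ≤ a'' → a'' < b'' → b'' ≤ b' → ∃ U ∈ Set.Ioo a'' b'', ∀ φ φ' : Literature.MathematicalPhysics.QuantumLattice.Fock (Literature.MathematicalPhysics.QuantumLattice.Orb (Literature.MathematicalPhysics.QuantumLattice.FermionTorus 2 L)), Literature.MathematicalPhysics.QuantumLattice.IsGroundStateInSector (Literature.MathematicalPhysics.QuantumLattice.hubbardTorus 2 L 1 U) (2 * ⌊(1 - δ) * (L : ℝ) ^ 2 / 2⌋₊) 0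 φ → Literature.MathematicalPhysics.QuantumLattice.IsGroundStateInSector (Literature.MathematicalPhysics.QuantumLattice.hubbardTorus 2 L 1 U) (2 * ⌊(1 - δ) * (L : ℝ) ^ 2 / 2⌋₊) 0 φ' → ∃ c : ℂ, φ' = c • φ) → Summit.HubbardSuperconductivity.HubbardSuperconductivity.Theses.JosephsonMirror.JmCusp :=
  fun h8807 hR => jmCusp_of_orderedWindow_of_genericSimplicity (stub_logColdGivesWindowOrder h8807) hR

/-- **stmt-2079 ∧ residue ⇒ `JmCusp`.**  The statement of stmt-HubbardSuperconductivity-2079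
`BalabanIR.BirGroundStateAverageLRO` (window ground-state-average `d`-wave order, verbatim) and the generic-simplicity
residue give the crux (`orderedWindow_of_bir2079`, p152676). [folklore] -/
theorem jmCusp_of_bir2079_of_genericSimplicity : (∃ δ ∈ Set.Ioo (0:ℝ) (1/2), ∃ U₁ U₂ c : ℝ, 0 < U₁ ∧ U₁ < U₂ ∧ 0 < c ∧ ∀ U ∈ Set.Ioo U₁ U₂, ∃ L₀ : ℕ, ∀ (L : ℕ) [NeZero L], L₀ ≤ L → Even L → let N : ℕ := 2 * ⌊(1 - δ) * (L : ℝ) ^ 2 / 2⌋₊; let H := Literature.MathematicalPhysics.QuantumLattice.hubbardTorus 2 L 1 U; let S := Literature.MathematicalPhysics.QuantumLattice.szSector (Λ := Literature.MathematicalPhysics.QuantumLattice.FermionTorus 2 L) N 0; let E₀ := S ⊓ Module.End.eigenspace (Matrix.toLin' H) ((H.minEnergyOn S : ℝ) : ℂ); let P := Literature.MathematicalPhysics.QuantumLattice.projMatrix (E₀.map (Literature.MathematicalPhysics.QuantumLattice.Fock.toEuclidean (ι := Literature.MathematicalPhysics.QuantumLattice.Orb (Literature.MathematicalPhysics.QuantumLattice.FermionTorus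 2 L)) : Literature.MathematicalPhysics.QuantumLattice.Fock (Literature.MathematicalPhysics.QuantumLattice.Orb (Literature.MathematicalPhysics.QuantumLattice.FermionTorus 2 L)) →ₗ[ℂ] EuclideanSpace ℂ (Finset (Literature.MathematicalPhysics.QuantumLattice.Orb (Literature.MathematicalPhysics.QuantumLattice.FermionTorus 2 L))))); c * (L : ℝ) ^ 4 * P.trace.re ≤ (P * (Matrix.conjTranspose (Literature.MathematicalPhysics.QuantumLattice.pairField Literature.MathematicalPhysics.QuantumLattice.dWaveFormFactor L) * Literature.MathematicalPhysics.QuantumLattice.pairField Literature.MathematicalPhysics.QuantumLattice.dWaveFormFactor L)).trace.re) → (∀ δ ∈ Set.Ioo (0:ℝ) (1 / 2), ∀ a b : ℝ, 0 < a → a < b → (∀ U ∈ Set.Ioo a b, ∃ c : ℝ, 0 < c ∧ ∀ ε : ℝ, 0 < ε → ∃ L₀ : ℕ, ∀ (L : ℕ) [NeZero L], Even L → L₀ ≤ L → ∃ n : ℕ, (n = 2 * ⌊(1 - δ) * (L : ℝ) ^ 2 / 2⌋₊ ∨ n = 2 * ⌊(1 - δ) * (L : ℝ) ^ 2 / 2⌋₊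 - 2) ∧ ∃ v : Literature.MathematicalPhysics.QuantumLattice.Fock (Literature.MathematicalPhysics.QuantumLattice.Orb (Literature.MathematicalPhysics.QuantumLattice.FermionTorus 2 L)), v ∈ Literature.MathematicalPhysics.QuantumLattice.szSector n 0 ∧ star v ⬝ᵥ v = 1 ∧ (star v ⬝ᵥ (Literature.MathematicalPhysics.QuantumLattice.hubbardTorus 2 L 1 U *ᵥ v)).re ≤ (Literature.MathematicalPhysics.QuantumLattice.hubbardTorus 2 L 1 U).minEnergyOn (Literature.MathematicalPhysics.QuantumLattice.szSector n 0) + ε * (L : ℝ) ^ 2 ∧ c * (L : ℝ) ^ 4 ≤ (star (Literature.MathematicalPhysics.QuantumLattice.pairField Literature.MathematicalPhysics.QuantumLattice.dWaveFormFactor L *ᵥ v) ⬝ᵥ (Literature.MathematicalPhysics.QuantumLattice.pairField Literature.MathematicalPhysics.QuantumLattice.dWaveFormFactor L *ᵥ v)).re) → ∃ a' b' : ℝ, a ≤ a' ∧ a' < b' ∧ b' ≤ b ∧ ∃ L₁ : ℕ, ∀ (L : ℕ) [NeZero L], Even L → L₁ ≤ L → ∀ a'' b'' : ℝ, a' ≤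 a'' → a'' < b'' → b'' ≤ b' → ∃ U ∈ Set.Ioo a'' b'', ∀ φ φ' : Literature.MathematicalPhysics.QuantumLattice.Fock (Literature.MathematicalPhysics.QuantumLattice.Orb (Literature.MathematicalPhysics.QuantumLattice.FermionTorus 2 L)), Literature.MathematicalPhysics.QuantumLattice.IsGroundStateInSector (Literature.MathematicalPhysics.QuantumLattice.hubbardTorus 2 L 1 U) (2 * ⌊(1 - δ) * (L : ℝ) ^ 2 / 2⌋₊) 0 φ → Literature.MathematicalPhysics.QuantumLattice.IsGroundStateInSector (Literature.MathematicalPhysics.QuantumLattice.hubbardTorus 2 L 1 U) (2 * ⌊(1 - δ) * (L : ℝ) ^ 2 / 2⌋₊) 0 φ' → ∃ c : ℂ, φ' = c • φ) → Summit.HubbardSuperconductivity.HubbardSuperconductivity.Theses.JosephsonMirror.JmCusp :=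
  fun h2079 hR => jmCusp_of_orderedWindow_of_genericSimplicity (orderedWindow_of_bir2079 h2079) hR

/-- **stmt-1634 ∧ residue ⇒ `JmCusp`.**  The statement of stmt-HubbardSuperconductivity-1634 `AbelianDuality.Thesis`
(block ground-state-average `d`-wave order with a uniform threshold, verbatim) and the generic-simplicity residue give
the crux (`orderedWindow_of_thesis1634`, p152676). [folklore] -/
theorem jmCusp_of_thesis1634_of_genericSimplicity : (∃ δ ∈ Set.Ioo (0:ℝ) (1/2), ∃ U₁ U₂ : ℝ, 0 < U₁ ∧ U₁ < U₂ ∧ ∃ c : ℝ, 0 < c ∧ ∃ L₀ : ℕ, ∀ U ∈ Set.Ioo U₁ U₂, ∀ (L : ℕ) [NeZero L], L₀ ≤ L → Even L → let p : Finset (Literature.MathematicalPhysics.QuantumLattice.Orb (Literature.MathematicalPhysics.QuantumLattice.FermionTorus 2 L)) → Prop := fun s => s.card = 2 * ⌊(1 - δ) * (L : ℝ) ^ 2 / 2⌋₊ ∧ 2 * (s.filter fun i => (ofLex i).2 = 0).card = 2 * ⌊(1 - δ) * (L : ℝ) ^ 2 / 2⌋₊; c * (L : ℝ) ^ 4 ≤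 (((Literature.MathematicalPhysics.QuantumLattice.hubbardTorus 2 L 1 U).toBlock p p).groundStateFunctional (((Literature.MathematicalPhysics.QuantumLattice.pairField Literature.MathematicalPhysics.QuantumLattice.dWaveFormFactor L)ᴴ * Literature.MathematicalPhysics.QuantumLattice.pairField Literature.MathematicalPhysics.QuantumLattice.dWaveFormFactor L).toBlock p p)).re) → (∀ δ ∈ Set.Ioo (0:ℝ) (1 / 2), ∀ a b : ℝ, 0 < a → a < b → (∀ U ∈ Set.Ioo a b, ∃ c : ℝ, 0 < c ∧ ∀ ε : ℝ, 0 < ε → ∃ L₀ : ℕ, ∀ (L : ℕ) [NeZero L], Even L → L₀ ≤ L → ∃ n : ℕ, (n = 2 * ⌊(1 - δ) * (L : ℝ) ^ 2 / 2⌋₊ ∨ n = 2 * ⌊(1 - δ) * (L : ℝ) ^ 2 / 2⌋₊ - 2) ∧ ∃ v : Literature.MathematicalPhysics.QuantumLattice.Fock (Literature.MathematicalPhysics.QuantumLattice.Orb (Literature.MathematicalPhysics.QuantumLattice.FermionTorus 2 L)), v ∈ Literature.MathematicalPhysics.QuantumLattice.szSector n 0 ∧ star v ⬝ᵥ v = 1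 ∧ (star v ⬝ᵥ (Literature.MathematicalPhysics.QuantumLattice.hubbardTorus 2 L 1 U *ᵥ v)).re ≤ (Literature.MathematicalPhysics.QuantumLattice.hubbardTorus 2 L 1 U).minEnergyOn (Literature.MathematicalPhysics.QuantumLattice.szSector n 0) + ε * (L : ℝ) ^ 2 ∧ c * (L : ℝ) ^ 4 ≤ (star (Literature.MathematicalPhysics.QuantumLattice.pairField Literature.MathematicalPhysics.QuantumLattice.dWaveFormFactor L *ᵥ v) ⬝ᵥ (Literature.MathematicalPhysics.QuantumLattice.pairField Literature.MathematicalPhysics.QuantumLattice.dWaveFormFactor L *ᵥ v)).re) → ∃ a' b' : ℝ, a ≤ a' ∧ a' < b' ∧ b' ≤ b ∧ ∃ L₁ : ℕ, ∀ (L : ℕ) [NeZero L], Even L → L₁ ≤ L → ∀ a'' b'' : ℝ, a' ≤ a'' → a'' < b'' → b'' ≤ b' → ∃ U ∈ Set.Ioo a'' b'', ∀ φ φ' : Literature.MathematicalPhysics.QuantumLattice.Fock (Literature.MathematicalPhysics.QuantumLattice.Orb (Literature.MathematicalPhysics.QuantumLattice.FermionTorus 2 L)), Literature.MathematicalPhysics.QuantumLattice.IsGroundStateInSector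 (Literature.MathematicalPhysics.QuantumLattice.hubbardTorus 2 L 1 U) (2 * ⌊(1 - δ) * (L : ℝ) ^ 2 / 2⌋₊) 0 φ → Literature.MathematicalPhysics.QuantumLattice.IsGroundStateInSector (Literature.MathematicalPhysics.QuantumLattice.hubbardTorus 2 L 1 U) (2 * ⌊(1 - δ) * (L : ℝ) ^ 2 / 2⌋₊) 0 φ' → ∃ c : ℂ, φ' = c • φ) → Summit.HubbardSuperconductivity.HubbardSuperconductivity.Theses.JosephsonMirror.JmCusp :=
  fun h1634 hR => jmCusp_of_orderedWindow_of_genericSimplicity (orderedWindow_of_thesis1634 h1634) hR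

end Summit.HubbardSuperconductivity.HubbardSuperconductivity.Theorems.JosephsonMirror

end
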